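import Literature.Barriers.NavierStokesRegularity.NavierStokesInequalityArrangement
import HarnessLib

/-!
# Conclusion of the geometric arrangement: (4.1)–(4.2) from the data of §5 (Ożański 2017, §5.5)

Barrier catalogue support file for `NavierStokesRegularity` (D-0021), on the discharge path of
fact C `Literature.Barriers.NavierStokesRegularity.NSIArrangementExists` of
`NavierStokesInequalityArrangement` (W. S. Ożański, arXiv:1709.00602v3, §5 = V. Scheffer,
Comm. Math. Phys. 101 (1985), §§4, 6). This file PROVES the last step of §5, **§5.5
"Construction of `f₂`, `φ₂`, `T` and conclusion of the arrangement"**, in the form in which it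
is consumed: once the two structures `(v₁,f₁,φ₁)` on `U₁` and `(v₂,f₂,φ₂)` on `U₂` (disjoint
closures) are in place together with

* the bound (5.26) `v₂ · F* ≥ -L` on `supp v₂` (printed `L = 1.1ε²B`; `F* = F[v₁,f₁]`),
  `f₂ = μ` on `supp v₂` ((5.30), Theorem 3.4), `|v₂| ≤ 2` (Lemma 5.2 (iii)), and
  `4 + TL < μ²` (printed: `μ² - 1.1ε²BT = 5 > |v₂|²`, (5.31));
* two planar regions `S₁` (printed `SBOX`) and `S₂` (printed `RECT`) on which `v₂ = x̂₁`
  (Lemma 5.2 (iv); tree coordinates: `v₂ = (0,1)`) and `F*₁ ≥ K₁` (printed `8B`), resp.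
  `F*₁ ≥ K₂` (printed `0.01B`) ((5.25)), such that every `x ∈ G = R(Ū₁ ∪ Ū₂)` has
  `y = R⁻¹(τx + z) ∈ S₁` (Case 1, (5.20)) or `y ∈ S₂` with `R⁻¹x ∉ Ū₂` (Case 2, (5.28): the points
  of `R(Ū^{a,r})`, where `f₂ ∘ R⁻¹ = 0`), and the two inequalities
  `τ⁻²(‖f₁‖_∞ + μ)² < TK₁`, `τ⁻²‖f₁‖_∞² < TK₂` (printed: `8TB ≥ (7.2/1.1)(μ/ε)² > τ⁻²(1.01μ)²`,
  `0.01TB ≥ (0.009/1.1)(μ/ε)² > τ⁻²(0.01μ)²`, with `μ ≥ 100‖f₁‖_∞`),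

then (4.1) and (4.2) hold, i.e. the data form an `IsNSIArrangement`
(`isNSIArrangement_of_cases`). The two verifications are `IsNSIStructure.sq_lt_of_lowerBound`
((5.28) ⇒ (4.1): "`f₂² + Tv₂·F* ≥ μ² - 1.1ε²BT = 5 > |v₂|²` in `supp v₂`, and the claim in
`U₂ ∖ supp v₂` follows trivially from positivity of `f₂` in `U₂`") and `gain_of_cases`
((5.29) ⇒ (4.2), Cases 1 and 2 verbatim). `printed_constants` records that the printed choices
`τ = 0.48ε` (5.16), `μ > 100`, `‖f₁‖_∞ ≤ μ/100` (5.30), `T = (μ² - 5)/(1.1ε²B)` (5.31),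
`K₁ = 8B`, `K₂ = 0.01B`, `L = 1.1ε²B` satisfy the three numerical hypotheses. Everything is a
`theorem`; no definitions, no named facts. The constants are kept symbolic (`L, K₁, K₂, M₁, μ`)
because the tree's Lemma 5.2 (`exists_ringField`) carries the constants `1.04ε²` and `Kε` in
place of the printed `ε²`, `ε/2`, which moves `L` (and hence the admissible `T`) by absolute
factors.

Tree coordinates (as in `NavierStokesInequalityArrangement`): plane points `q = (r, z)`
(Ożański's `(x₂, x₁)`), `v = (v_r, v_z)` (his `(v₂₂, v₂₁)`), `F = (F_r, F_z)` (his `(F₂, F₁)`),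
so his `v₂ = (1,0)` reads `v₂ q = (0, 1)` and his `F₁*` is `(F q).2`; `R⁻¹ = meridian`,
`Γx = τ • x + z`.

## References

* W. S. Ożański, *On weak solutions to the Navier–Stokes inequality with internal
  singularities*, arXiv:1709.00602v3, §5.5 ((5.28)–(5.31) and Cases 1–2), with (5.20), (5.25),
  (5.26), Lemma 5.2 (iii)–(iv). [`Ozanski2017NSISingular`]
* V. Scheffer, *A solution to the Navier–Stokes inequality with an internal singularity*,
  Comm. Math. Phys. 101 (1985), 47–85, Lemma 6.3 (the hypotheses (3.1)–(3.7) of §3 hold).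
  [`Scheffer1985`]
-/

noncomputable section

open Set

namespace Literature.Barriers.NavierStokesRegularity

open Literature.Analysis.FluidPDE

variable {U₁ U₂ : Set (ℝ × ℝ)} {v₁ : ℝ × ℝ → ℝ × ℝ} {f₁ φ₁ : ℝ × ℝ → ℝ} {v₂ : ℝ × ℝ → ℝ × ℝ}
  {f₂ φ₂ : ℝ × ℝ → ℝ}

/-! ### (5.28): the inequality (4.1) in `U₂` -/

/-- **(5.28) ⇒ (4.1)** (Ożański 2017, §5.5: "Using (5.26) and the fact that `|v₂| ≤ 2` we
immediately obtain (5.28) by writing `f₂² + Tv₂·F* ≥ μ² - 1.1ε²BT = 5 > |v₂|²` in `supp v₂`,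
and the claim in `U₂ ∖ supp v₂` follows trivially from positivity of `f₂` in `U₂`"). Symbolic
form: if `(v₂,f₂,φ₂)` is a structure on `U₂`, `f₂ = μ` and `v₂·F ≥ -L` wherever `v₂ ≠ 0` in
`U₂`, `|v₂|² ≤ 4` and `4 + TL < μ²` (`T ≥ 0`), then `|v₂|² < f₂² + Tv₂·F` in `U₂`.
[cite: Ozanski2017NSISingular, §5.5 (5.28)] -/
theorem IsNSIStructure.sq_lt_of_lowerBound (h₂ : IsNSIStructure U₂ v₂ f₂ φ₂)
    {F : ℝ × ℝ → ℝ × ℝ} {T μ L : ℝ} (hT : 0 ≤ T)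
    (hf₂μ : ∀ q ∈ U₂, v₂ q ≠ 0 → f₂ q = μ)
    (hv₂ : ∀ q, (v₂ q).1 ^ 2 + (v₂ q).2 ^ 2 ≤ 4)
    (hlow : ∀ q ∈ U₂, v₂ q ≠ 0 → -L ≤ (v₂ q).1 * (F q).1 + (v₂ q).2 * (F q).2)
    (h41 : 4 + T * L < μ ^ 2) {q : ℝ × ℝ} (hq : q ∈ U₂) :
    (v₂ q).1 ^ 2 + (v₂ q).2 ^ 2 <
      f₂ q ^ 2 + T * ((v₂ q).1 * (F q).1 + (v₂ q).2 * (F q).2) := by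
  by_cases hv : v₂ q = 0
  · -- off `supp v₂`: positivity of `f₂` in `U₂` (`f₂ > |v₂| = 0`)
    have h := h₂.sq_lt q hq
    rw [hv] at h ⊢
    simpa using h
  · -- on `supp v₂`: `f₂ = μ`, `v₂·F ≥ -L`, `|v₂|² ≤ 4 < μ² - TL`
    have hf := hf₂μ q hq hv
    have hl := hlow q hq hv
    have h4 := hv₂ q
    have hTl : T * (-L) ≤ T * ((v₂ q).1 * (F q).1 + (v₂ q).2 * (F q).2) :=
      mul_le_mul_of_nonneg_left hl hT
    rw [hf]
    linarith

/-! ### (5.29): the inequality (4.2) on `G`, by the two cases of §5.5 -/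

/-- **(5.29) ⇒ (4.2), Cases 1 and 2** (Ożański 2017, §5.5). Symbolic form, at one pair of
plane points `x' = R⁻¹x`, `y = R⁻¹(Γx)`: if `0 ≤ f₁ ≤ M₁` (structure on `U₁`), `0 ≤ f₂ ≤ μ`
(structure on `U₂`), `v₂ = x̂₁` and `F₁ ≥ K₁` on `S₁` (printed `SBOX`, `K₁ = 8B`), `v₂ = x̂₁` and
`F₁ ≥ K₂` on `S₂` (printed `RECT`, `K₂ = 0.01B`), `τ⁻²(M₁ + μ)² < TK₁` and `τ⁻²M₁² < TK₂`, then
in Case 1 (`y ∈ S₁`): `f₂(y)² + Tv₂(y)·F(y) ≥ TK₁ > τ⁻²(M₁ + μ)² ≥ τ⁻²(f₁(x') + f₂(x'))²`, and in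
Case 2 (`y ∈ S₂`, `x' ∉ Ū₂` so `f₂(x') = 0`): `… ≥ TK₂ > τ⁻²M₁² ≥ τ⁻²f₁(x')²`.
[cite: Ozanski2017NSISingular, §5.5 (5.29), Cases 1–2] -/
theorem gain_of_cases (h₁ : IsNSIStructure U₁ v₁ f₁ φ₁) (h₂ : IsNSIStructure U₂ v₂ f₂ φ₂)
    {F : ℝ × ℝ → ℝ × ℝ} {T τ μ M₁ K₁ K₂ : ℝ} {S₁ S₂ : Set (ℝ × ℝ)} (hT : 0 ≤ T)
    (hM₁ : ∀ q, f₁ q ≤ M₁) (hμ : ∀ q, f₂ q ≤ μ)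
    (hS₁ : ∀ y ∈ S₁, v₂ y = (0, 1) ∧ K₁ ≤ (F y).2)
    (hS₂ : ∀ y ∈ S₂, v₂ y = (0, 1) ∧ K₂ ≤ (F y).2)
    (hK₁ : τ⁻¹ ^ 2 * (M₁ + μ) ^ 2 < T * K₁) (hK₂ : τ⁻¹ ^ 2 * M₁ ^ 2 < T * K₂)
    {x' y : ℝ × ℝ} (hcase : y ∈ S₁ ∨ (y ∈ S₂ ∧ x' ∉ closure U₂)) :
    τ⁻¹ ^ 2 * (f₁ x' + f₂ x') ^ 2 <
      f₂ y ^ 2 + T * ((v₂ y).1 * (F y).1 + (v₂ y).2 * (F y).2) := by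
  have hf₁0 : 0 ≤ f₁ x' := h₁.f_nonneg x'
  have hf₂0 : 0 ≤ f₂ x' := h₂.f_nonneg x'
  have hτ0 : 0 ≤ τ⁻¹ ^ 2 := sq_nonneg _
  have hfy : 0 ≤ f₂ y ^ 2 := sq_nonneg _
  rcases hcase with hy | ⟨hy, hx⟩
  · -- Case 1: `y ∈ SBOX`
    obtain ⟨hv, hK⟩ := hS₁ y hy
    have hsum : (f₁ x' + f₂ x') ^ 2 ≤ (M₁ + μ) ^ 2 :=
      pow_le_pow_left₀ (add_nonneg hf₁0 hf₂0) (add_le_add (hM₁ x') (hμ x')) 2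
    have h1 : τ⁻¹ ^ 2 * (f₁ x' + f₂ x') ^ 2 ≤ τ⁻¹ ^ 2 * (M₁ + μ) ^ 2 :=
      mul_le_mul_of_nonneg_left hsum hτ0
    have h2 : T * K₁ ≤ T * (F y).2 := mul_le_mul_of_nonneg_left hK hT
    rw [hv]
    simp only [zero_mul, one_mul, zero_add]
    linarith
  · -- Case 2: `y ∈ RECT`, `f₂(x') = 0`
    obtain ⟨hv, hK⟩ := hS₂ y hy
    have hf₂x : f₂ x' = 0 := h₂.f_eq_zero hx
    have hsq : f₁ x' ^ 2 ≤ M₁ ^ 2 := pow_le_pow_left₀ hf₁0 (hM₁ x') 2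
    have h1 : τ⁻¹ ^ 2 * f₁ x' ^ 2 ≤ τ⁻¹ ^ 2 * M₁ ^ 2 := mul_le_mul_of_nonneg_left hsq hτ0
    have h2 : T * K₂ ≤ T * (F y).2 := mul_le_mul_of_nonneg_left hK hT
    rw [hv, hf₂x, add_zero]
    simp only [zero_mul, one_mul, zero_add]
    linarith

/-! ### The arrangement from the data of §5 -/

/-- **Conclusion of the geometric arrangement** (Ożański 2017, §5.5: "It remains to construct
`f₂`, `φ₂`, `T` such that `(v₂,f₂,φ₂)` is a structure on `U₂` and properties (4.1), (4.2) hold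
… Hence we obtain (5.29). This concludes the construction of geometric arrangement"; Scheffer
1985, Lemma 6.3). Given structures `(v₁,f₁,φ₁)` on `U₁ ≠ ∅` and `(v₂,f₂,φ₂)` on `U₂` with
disjoint closures, `T > 0`, `τ ∈ (0,1)`, `z ∈ ℝ³`, and, with `F* = F[v₁,f₁]`: the bounds
`0 ≤ f₁ ≤ M₁`, `f₂ ≤ μ`, `f₂ = μ` and `v₂·F* ≥ -L` on `supp v₂ ∩ U₂` ((5.26), (5.30)),
`|v₂|² ≤ 4`, `4 + TL < μ²`; regions `S₁ ⊇ R⁻¹(Γ(R(BOX)))` and `S₂ ⊇ R⁻¹(Γ(R(Ū^{a,r})))` with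
`v₂ = x̂₁`, `F*₁ ≥ K₁` on `S₁` and `v₂ = x̂₁`, `F*₁ ≥ K₂` on `S₂` ((5.20), (5.25), (5.28),
Lemma 5.2 (iv)), the case split `R⁻¹(Γx) ∈ S₁ ∨ (R⁻¹(Γx) ∈ S₂ ∧ R⁻¹x ∉ Ū₂)` for `x ∈ G`, and
`τ⁻²(M₁ + μ)² < TK₁`, `τ⁻²M₁² < TK₂` ((5.31)) — the data form a geometric arrangement
(`IsNSIArrangement`, (4.1)–(4.3)). [cite: Ozanski2017NSISingular, §5.5 (5.28)–(5.29)]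
[cite: Scheffer1985, Lemma 6.3] -/
theorem isNSIArrangement_of_cases (h₁ : IsNSIStructure U₁ v₁ f₁ φ₁)
    (h₂ : IsNSIStructure U₂ v₂ f₂ φ₂) (hdisj : Disjoint (closure U₁) (closure U₂))
    (hne : U₁.Nonempty) {T τ : ℝ} {z : EuclideanSpace ℝ (Fin 3)} (hT : 0 < T) (hτ : τ ∈ Ioo (0 : ℝ) 1)
    {μ M₁ L K₁ K₂ : ℝ} {S₁ S₂ : Set (ℝ × ℝ)}
    (hM₁ : ∀ q, f₁ q ≤ M₁) (hμ : ∀ q, f₂ q ≤ μ)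
    (hf₂μ : ∀ q ∈ U₂, v₂ q ≠ 0 → f₂ q = μ)
    (hv₂ : ∀ q, (v₂ q).1 ^ 2 + (v₂ q).2 ^ 2 ≤ 4)
    (hlow : ∀ q ∈ U₂, v₂ q ≠ 0 →
      -L ≤ (v₂ q).1 * (pressureInteraction v₁ f₁ q).1 + (v₂ q).2 * (pressureInteraction v₁ f₁ q).2)
    (h41 : 4 + T * L < μ ^ 2)
    (hS₁ : ∀ y ∈ S₁, v₂ y = (0, 1) ∧ K₁ ≤ (pressureInteraction v₁ f₁ y).2)
    (hS₂ : ∀ y ∈ S₂, v₂ y = (0, 1) ∧ K₂ ≤ (pressureInteraction v₁ f₁ y).2)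
    (hcases : ∀ x ∈ revolve (closure U₁ ∪ closure U₂),
      meridian (τ • x + z) ∈ S₁ ∨ (meridian (τ • x + z) ∈ S₂ ∧ meridian x ∉ closure U₂))
    (hK₁ : τ⁻¹ ^ 2 * (M₁ + μ) ^ 2 < T * K₁) (hK₂ : τ⁻¹ ^ 2 * M₁ ^ 2 < T * K₂) :
    IsNSIArrangement U₁ U₂ v₁ f₁ φ₁ v₂ f₂ φ₂ T τ z where
  structure₁ := h₁
  structure₂ := h₂
  disjoint := hdisj
  nonempty := hne
  T_pos := hT
  τ_mem := hτ
  sq_lt _ hq := h₂.sq_lt_of_lowerBound hT.le hf₂μ hv₂ hlow h41 hq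
  gain x hx := gain_of_cases h₁ h₂ hT.le hM₁ hμ hS₁ hS₂ hK₁ hK₂ (hcases x hx)

/-! ### The printed constants -/

/-- **The printed constants satisfy the three numerical hypotheses** (Ożański 2017, §5.5,
(5.30)–(5.31) with (5.16)): with `τ = 0.48ε`, `μ > 100`, `T = (μ² - 5)/(1.1ε²B)` (`ε, B > 0`),
`L = 1.1ε²B`, `K₁ = 8B`, `K₂ = 0.01B`, `M₁ = μ/100`:
`4 + TL = μ² - 1 < μ²` ("`μ² - 1.1ε²BT = 5 > |v₂|²`"),
`τ⁻²(μ/100 + μ)² < 8TB` ("`8TB ≥ (7.2/1.1)(μ/ε)² > (1.01/0.48)²(μ/ε)² = τ⁻²(1.01μ)²`") and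
`τ⁻²(μ/100)² < 0.01TB` ("`0.01TB ≥ (0.009/1.1)(μ/ε)² > (0.01/0.48)²(μ/ε)² = τ⁻²(0.01μ)²`").
[cite: Ozanski2017NSISingular, §5.5 (5.30)–(5.31)] -/
theorem printed_constants {ε μ B T τ : ℝ} (hε : 0 < ε) (hB : 0 < B) (hμ : 100 < μ)
    (hT : T = (μ ^ 2 - 5) / (11 / 10 * ε ^ 2 * B)) (hτ : τ = 48 / 100 * ε) :
    4 + T * (11 / 10 * ε ^ 2 * B) < μ ^ 2 ∧
      τ⁻¹ ^ 2 * (μ / 100 + μ) ^ 2 < T * (8 * B) ∧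
      τ⁻¹ ^ 2 * (μ / 100) ^ 2 < T * (B / 100) := by
  have hε2 : 0 < ε ^ 2 := by positivity
  have hμ2 : 10000 < μ ^ 2 := by nlinarith
  have hden : 0 < 11 / 10 * ε ^ 2 * B := by positivity
  have hTL : T * (11 / 10 * ε ^ 2 * B) = μ ^ 2 - 5 := by
    rw [hT, div_mul_cancel₀ _ hden.ne']
  have hτinv : τ⁻¹ ^ 2 = (100 / 48) ^ 2 / ε ^ 2 := by
    rw [hτ, inv_pow, mul_pow]; field_simp
  refine ⟨by linarith, ?_, ?_⟩
  · -- `8TB = (80/11)(μ² - 5)/ε²` against `(100/48)²(1.01 μ)²/ε²`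
    have h8 : T * (8 * B) = 80 / 11 * (μ ^ 2 - 5) / ε ^ 2 := by
      rw [hT]; field_simp; ring
    rw [hτinv, h8, div_mul_eq_mul_div, div_lt_div_iff_of_pos_right hε2]
    nlinarith
  · -- `0.01TB = (μ² - 5)/(110 ε²)` against `(100/48)²(μ/100)²/ε²`
    have h01 : T * (B / 100) = 1 / 110 * (μ ^ 2 - 5) / ε ^ 2 := by
      rw [hT]; field_simp; ring
    rw [hτinv, h01, div_mul_eq_mul_div, div_lt_div_iff_of_pos_right hε2]
    nlinarith

end Literature.Barriers.NavierStokesRegularity
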